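import Mathlib
import Literature.Computability.AlgebraicComplexity.DepthThreeRankBound
import Summits.ValiantsHypothesis.ValiantsHypothesis.Theorems.MonotoneRestorationMixingScaleDefs
import Summits.ValiantsHypothesis.ValiantsHypothesis.Theorems.MonotoneRestorationMixingScaleLevelMatchingData
import HarnessLib

/-!
# M3 of the line `mixing-scale`: ORBIT-LINKED CLASS SUMS ARE INVARIANT (ORBIT currency)

Route MonotoneRestoration, crux `OrbitRestorationQP` (stmt-ValiantsHypothesis-18293), line `mixing-scale` (val-idea-12, skeleton
`Cruxes/OrbitRestorationQP/Lines/mixing_scale.lean`), registered stub **M3** `stub_orbitClassSums : depthThree_rankBound → OrbitClassSums`,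
landed here BY NAME in namespace `Summit.ValiantsHypothesis.ValiantsHypothesis.Theorems.OrbitRestorationQPMixingScale` over the
Theorems-side vocabulary `…MixingScaleDefs.lean` (same names and bodies as the skeleton, which re-points by `open`).

THE ARGUMENT (rank-bound bridge only — no mixing, no largeness of `n`).  Fix a matrix-symmetric `f`, a clean minimal representation
`R` (`Σ_i T_i = f`, no vanishing sub-sum) and an even renaming `φ = mact σ τ`.  The signed family `{T_i} ∪ {−φ T_j}` sums to
`f − φ f = 0`; decompose it into MINIMAL vanishing sub-families (`ClusterMatching.exists_decomposition`).  Each block is MIXED (a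
one-sided vanishing block would be a vanishing sub-sum of `R` or of `φ R`) and `Rb`-CLOSE in rank distance (the Saxena–Seshadhri rank
bound via `RankBoundBridge.rdist_lt_of_minVanishing`; two-term blocks have equal factor multisets) — this is the exposed matching data
`LevelRep.exists_matchingData_of_fix`.  A left member `T_i` and a right member `−φ T_j` of one block therefore satisfy
`rdist (L i) (act φ (L j)) ≤ Rb`, i.e. `OrbitClose R i j`; so every orbit-linked class `S = orbitClass R i₀` (an equivalence class of
the equivalence generated by `OrbitClose`) is CLOSED under the links of the blocks, and the abstract cancellation
`ClusterMatching.sum_add_sum_eq_zero_of_closed` gives `Σ_{j ∈ S} T_j − φ (Σ_{j ∈ S} T_j) = 0`.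

* `orbitClose_of_rdist_le`, `mem_orbitClass_iff`, `mem_orbitClass_self`, `mem_orbitClass_iff_of_eqvGen` — bookkeeping of the classes;
* `mact_sum_eq_of_closed` — the cancellation for ANY index set closed under `OrbitClose`-generated equivalence at the given `(σ, τ)`;
* `stub_orbitClassSums` — **M3**, verbatim the registered signature.

Proved modulo the named fact `depthThree_rankBound` (Saxena–Seshadhri 2013, Theorem 5), which enters BY NAME as the hypothesis of the
stub exactly as in the landed A_k.  Honest framing: M3 is one M-sized input of the line; the line's load-bearing stub M4 (Theorem S′)
and the rung `ProductDepthRestorationQP (fun _ => 1)` stay OPEN, and nothing here bears on VP ≠ VNP.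
[cite: KarninShpilka2009, §3; SaxenaSeshadhri2013, Theorem 5]
-/

noncomputable section

open MvPolynomial Equiv Literature.Computability.AlgebraicComplexity

-- `Summit.ValiantsHypothesis.ValiantsHypothesis.…` is the tree's single-conjunct layout (Sub = Summit).
set_option linter.dupNamespace false

namespace Summit.ValiantsHypothesis.ValiantsHypothesis.Theorems.OrbitRestorationQPMixingScale

open RankDistance LevelRep LevelStructure ClusterMatching

variable {n D : ℕ} {f : MvPolynomial (Fin n × Fin n) ℂ}

/-! ### Bookkeeping of the orbit-linked classes -/

/-- A pair witnessed close under an even renaming is orbit-close. [folklore] -/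
theorem orbitClose_of_rdist_le (R : CleanRep f D) {i j : Fin R.m} {σ τ : Perm (Fin n)} (hσ : Perm.sign σ = 1)
    (hτ : Perm.sign τ = 1) (h : rdist (R.L i) (act (mact σ τ) (R.L j)) ≤ Rb R.m D) : OrbitClose R i j :=
  ⟨σ, τ, hσ, hτ, h⟩

/-- Membership in an orbit-linked class is generated equivalence. [folklore] -/
theorem mem_orbitClass_iff (R : CleanRep f D) {i j : Fin R.m} :
    j ∈ orbitClass R i ↔ Relation.EqvGen (OrbitClose R) i j := by
  classical
  simp [orbitClass]

/-- Every term lies in its own orbit-linked class. [folklore] -/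
theorem mem_orbitClass_self (R : CleanRep f D) (i : Fin R.m) : i ∈ orbitClass R i :=
  (mem_orbitClass_iff R).2 (Relation.EqvGen.refl i)

/-- Equivalent terms lie in the same orbit-linked classes. [folklore] -/
theorem mem_orbitClass_iff_of_eqvGen (R : CleanRep f D) {i j j' : Fin R.m} (h : Relation.EqvGen (OrbitClose R) j j') :
    j ∈ orbitClass R i ↔ j' ∈ orbitClass R i := by
  rw [mem_orbitClass_iff, mem_orbitClass_iff]
  exact ⟨fun hj => Relation.EqvGen.trans _ _ _ hj h, fun hj' => Relation.EqvGen.trans _ _ _ hj' (Relation.EqvGen.symm _ _ h)⟩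

/-! ### The cancellation -/

/-- **An even renaming fixes the sum of the terms over any index set closed under orbit-closeness.**  If `f` is matrix-symmetric, `R` a
clean minimal representation, `(σ, τ)` even, and `S` satisfies `OrbitClose R i j → (i ∈ S ↔ j ∈ S)`, then
`mact σ τ (Σ_{j ∈ S} T_j) = Σ_{j ∈ S} T_j`.  Granting the Saxena–Seshadhri rank bound. [cite: KarninShpilka2009, §3; SaxenaSeshadhri2013,
Theorem 5] -/
theorem mact_sum_eq_of_closed (hRB : depthThree_rankBound) (hsym : ∀ σ τ : Perm (Fin n), mact σ τ f = f) (R : CleanRep f D)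
    (S : Finset (Fin R.m)) (hS : ∀ i j : Fin R.m, OrbitClose R i j → (i ∈ S ↔ j ∈ S)) {σ τ : Perm (Fin n)}
    (hσ : Perm.sign σ = 1) (hτ : Perm.sign τ = 1) :
    mact σ τ (∑ j ∈ S, R.T j) = ∑ j ∈ S, R.T j := by
  classical
  obtain ⟨Dm, hinl, hinr, hΔ, -, hR⟩ :=
    exists_matchingData_of_fix hRB R (mact σ τ) (totalDegree_mact σ τ) (hsym σ τ)
  have hcl : ∀ s : Finset (Fin R.m ⊕ Fin R.m), MinVanishing Dm.val s →
      ∀ i j : Fin R.m, Sum.inl i ∈ s → Sum.inr j ∈ s → (i ∈ S ↔ j ∈ S) := by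
    intro s hs i j hi hj
    refine hS i j (orbitClose_of_rdist_le R hσ hτ ?_)
    rw [← hΔ, ← hR]
    exact Dm.close s hs _ hi _ hj
  have h0 := sum_add_sum_eq_zero_of_closed Dm.val Dm.total Dm.mixed S hcl
  simp only [hinl, hinr, Finset.sum_neg_distrib, ← map_sum] at h0
  rw [add_neg_eq_zero] at h0
  exact h0.symm

/-! ### M3 -/

/-- **M3 — ORBIT-LINKED CLASS SUMS ARE INVARIANT** (registered stub `stub_orbitClassSums` of the line `mixing-scale`, verbatim signature):
granting the Saxena–Seshadhri rank bound, every even row/column renaming fixes the sum of the terms of each orbit-linked class of a clean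
minimal representation of a matrix-symmetric polynomial.  From the rank-bound bridge alone (no mixing, no largeness): the minimal vanishing
sub-families of `{T_i} ∪ {−(σ,τ)·T_j}` are mixed and `Rb`-close, hence link only indices of one orbit-linked class, and the class is closed
under such links. [cite: KarninShpilka2009, §3; SaxenaSeshadhri2013, Theorem 5] -/
theorem stub_orbitClassSums : depthThree_rankBound → OrbitClassSums := by
  intro hRB n D f hsym R i σ τ hσ hτ
  exact mact_sum_eq_of_closed hRB hsym R (orbitClass R i)
    (fun j j' hjj' => mem_orbitClass_iff_of_eqvGen R (Relation.EqvGen.rel _ _ hjj')) hσ hτ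

end Summit.ValiantsHypothesis.ValiantsHypothesis.Theorems.OrbitRestorationQPMixingScale

end
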